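import Literature.NumberTheory.LFunctions.HeilbronnPhenomenonElementaryProofs
import Literature.NumberTheory.LFunctions.PrimitiveQuadraticCharacterPrimeValues
import Literature.NumberTheory.QuadraticFields.GaussCountDirichletSeries
import Mathlib.NumberTheory.ZetaValues
import HarnessLib

/-!
# `(1 ∗ χ_D)(n) = Σ_{u² a = n} ρ_D(a)` — the divisor sum of a real character counted by the
# square roots of the discriminant modulo `4a`, for a fundamental discriminant `D` of EITHER sign

Topic `Literature/NumberTheory/LFunctions` (namespace `Literature.NumberTheory.LFunctions.DiscRootCount`;
continuing `RealCharacterDivisorSums.lean` — `RealChar.charDivisorSum χ = r = 1 ∗ χ` — and the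
sign-generic engine `QuadraticFields/GaussRepresentationCount.lean` — the roots of
`M² + βM + e ≡ 0 (mod E)`, `Quadratic.BinQF.qroots`). Everything here is PROVED (theorems, and two
definitions with bodies: the root set `sqrtsMod D n` and the real arithmetic function `rho D`); no
named fact.

This is the arithmetic half of Goldfeld–Schinzel's Lemma 1 (D. M. Goldfeld, A. Schinzel, *On Siegel's
zero*, Ann. Scuola Norm. Sup. Pisa (4) **2** (1975) 571–583, §2 p. 572–573): "Every ideal `𝔞` of
`𝔒(√d)` can be represented in the form `𝔞 = u[a, (b + √d)/2]` where `u`, `a` are positive integers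
and `b² ≡ d (mod 4a)` (see [5], Theorem 59). If we impose the condition that `−a < b ≤ a` then the
representation becomes unique. Since `N𝔞 = u²a`, it follows that (3)
`Σ_{N𝔞 ≤ x} 1/N𝔞 = Σ' (1/a) Σ_{1 ≤ u² ≤ x/a} 1/u² + …`", in the language of the tree: the number of
ideals of norm `n` of the quadratic field of discriminant `D` is `r(n) = Σ_{k ∣ n} χ_D(k)` (the
coefficient of `ζ_K = ζ · L(χ_D)`), and

  `r(n) = Σ_{u² a = n} ρ_D(a)`,  `ρ_D(a) = #{b (mod 2a) : b² ≡ D (mod 4a)}`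

(Oesterlé, *Le problème de Gauss sur le nombre de classes*, Enseign. Math. 34 (1988) II §2 (23),
(25)–(26): `ζ_K(s) = ζ(2s) Σ ρ(n) n^{−s} = ζ(s)L(χ, s)` — proved in the tree as DIRICHLET SERIES for
NEGATIVE discriminants only, `Quadratic.BinQF.riemannZeta_mul_LSeries_card_sqrtsMod`; here as an
identity of arithmetic functions, for both signs, by multiplicativity and the local values at prime
powers). Consumers: the discharges of `goldfeldSchinzel1975_lemma1` / `_theorem1`
(`SiegelZeroFormSumAsymptotic.lean`), where `ρ_D(a)` restricted to `a < ¼√|D|` is the form count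
`GoldfeldSchinzel1975.pairCount D a` of the window `−a < b ≤ a`.

## Contents

* `sqrtsMod D n` (the `b ∈ [0, 2n)` with `4n ∣ b² − D`) and `rho D` (its cardinality as a real
  arithmetic function); the bridge `card_sqrtsMod_eq_card_qroots` to `BinQF.qroots β e n`,
  `D = β² − 4e`, `β ∈ {0, 1}`.
* Local structure for a FUNDAMENTAL `D` (either sign): `card_sqrtsMod_mul` (CRT),
  `card_sqrtsMod_prime_pow_of_mem` (`= 2`, split), `card_sqrtsMod_prime_of_dvd` (`= 1`),
  `card_sqrtsMod_prime_pow_of_dvd` (`= 0`, `k ≥ 2`), `card_sqrtsMod_prime_pow_of_not_mem` (`= 0`,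
  inert), `card_sqrtsMod_prime_pow_le_two`, `isMultiplicative_rho`.
* **`charDivisorSum_eq_sqInd_mul_rho`** — `r = 1_□ ∗ ρ_D` for every quadratic Dirichlet character
  `χ` whose values at the primes are the Kronecker symbols `(D/p)`; and
  `charDivisorSum_eq_sqInd_mul_rho_of_isPrimitive` — the same for the primitive quadratic character
  mod `q > 1` and `D = χ(−1) q` (the tree's dictionary `PrimitiveQuadratic.*`).
* **`sum_charDivisorSum_div_eq`** — Goldfeld–Schinzel's (3) as an exact finite identity:
  `Σ_{n ≤ N} r(n)/n = Σ_{a ≤ N} (ρ_D(a)/a) · Σ_{u ≤ √(N/a)} 1/u²`, with the two comparison sums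
  `sum_inv_sq_le` (`Σ_{u ≤ U} 1/u² ≤ π²/6`) and `pi_sq_div_six_sub_le_sum_inv_sq` (`≥ π²/6 − 1/U`).

## References

* D. M. Goldfeld, A. Schinzel, On Siegel's zero, Ann. Scuola Norm. Sup. Pisa (4) 2 (1975), §2,
  proof of Lemma 1, pp. 572–573, display (3). [GoldfeldSchinzel1975]
* J. Oesterlé, Le problème de Gauss sur le nombre de classes, Enseign. Math. 34 (1988), II §1
  Corollaire p. 54 and II §2 (25)–(26) p. 56. [Oesterle1988Gauss]
-/

noncomputable section

open Finset ArithmeticFunction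
open scoped ArithmeticFunction.zeta

namespace Literature.NumberTheory.LFunctions.DiscRootCount

open Literature.NumberTheory.QuadraticFields.Quadratic.BinQF (qroots mem_qroots card_qroots_mul
  card_qroots_prime_pow_eq_two card_qroots_prime_eq_one qroots_prime_pow_eq_empty_of_dvd
  qroots_prime_pow_eq_empty_of_not_mem card_qroots_eq_one_of_squarefree card_qroots_eq_two_pow)
open Literature.NumberTheory.QuadraticFields.BinaryQuadraticForm (kroneckerOnePrimes
  mem_kroneckerOnePrimes prime_of_mem_kroneckerOnePrimes not_dvd_of_mem_kroneckerOnePrimes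
  two_mem_kroneckerOnePrimes_iff mem_kroneckerOnePrimes_iff_of_ne_two jacobiSym_eq_zero_of_prime_dvd
  jacobiSym_eq_one_of_mem_kroneckerOnePrimes jacobiSym_eq_neg_one_of_not_mem_kroneckerOnePrimes)
open Literature.NumberTheory.LFunctions.DirichletAbel (reChar reChar_apply)
open Literature.NumberTheory.LFunctions.RealChar (charDivisorSum charDivisorSum_prime_pow
  charDivisorSum_prime isMultiplicative_charDivisorSum)
open Literature.NumberTheory.LFunctions.Pintz1976Heilbronn (sqInd sqInd_apply isMultiplicative_sqInd
  sqInd_prime_pow sum_Ioc_sum_divisors_eq)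

/-! ### The root count `ρ_D(n)` -/

/-- The square roots of `D` modulo `4n`, normalised to `b ∈ [0, 2n)`: the `b < 2n` with
`b² ≡ D (mod 4n)`; for a fundamental discriminant `D` and `n ≥ 1` these index the primitive ideals
`[n, (b + √D)/2]` of norm `n` of `ℚ(√D)`. [cite: GoldfeldSchinzel1975, §2 proof of Lemma 1 p. 572–573]
[cite: Oesterle1988Gauss, II §1 Théorème p. 54] -/
def sqrtsMod (D : ℤ) (n : ℕ) : Finset ℕ :=
  (range (2 * n)).filter (fun b : ℕ => (4 * (n : ℤ)) ∣ (b : ℤ) ^ 2 - D)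

/-- `ρ_D(n) = #sqrtsMod D n` as a real arithmetic function (`ρ_D(0) = 0`).
[cite: Oesterle1988Gauss, II §2 (25) p. 56] -/
def rho (D : ℤ) : ArithmeticFunction ℝ :=
  ⟨fun n => ((sqrtsMod D n).card : ℝ), by simp [sqrtsMod]⟩

/-- Unfolding `sqrtsMod`. [cite: Oesterle1988Gauss, II §1 Théorème p. 54] -/
theorem mem_sqrtsMod {D : ℤ} {n b : ℕ} :
    b ∈ sqrtsMod D n ↔ b < 2 * n ∧ (4 * (n : ℤ)) ∣ (b : ℤ) ^ 2 - D := by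
  simp [sqrtsMod]

/-- Unfolding `rho`. [cite: Oesterle1988Gauss, II §2 (25) p. 56] -/
theorem rho_apply (D : ℤ) (n : ℕ) : rho D n = ((sqrtsMod D n).card : ℝ) := rfl

/-- `ρ_D(n) ≥ 0`. [cite: Oesterle1988Gauss, II §2 (25) p. 56] -/
theorem rho_nonneg (D : ℤ) (n : ℕ) : 0 ≤ rho D n := by
  rw [rho_apply]; positivity

/-! ### The bridge to the roots of `M² + βM + e` (`D = β² − 4e`, `b = 2M + β`) -/

/-- `D = β² − 4e` with `β ∈ {0, 1}` when `D ≡ 0, 1 (mod 4)`. [cite: Oesterle1988Gauss, II §1 Théorème p. 54] -/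
theorem exists_beta_e {D : ℤ} (h4 : D % 4 = 0 ∨ D % 4 = 1) :
    ∃ (β : ℕ) (e : ℤ), (β = 0 ∨ β = 1) ∧ ((β : ℕ) : ℤ) ^ 2 - 4 * e = D := by
  rcases h4 with h0 | h1
  · exact ⟨0, -(D / 4), Or.inl rfl, by push_cast; omega⟩
  · exact ⟨1, -((D - 1) / 4), Or.inr rfl, by push_cast; omega⟩

/-- `#{0 ≤ b < 2n : 4n ∣ b² − D} = #{0 ≤ M < n : n ∣ M² + βM + e}` when `D = β² − 4e`, `β ∈ {0, 1}`
(`b = 2M + β`; the computation of `GaussRepresentationCount.lean` for either sign of `D`).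
[cite: Oesterle1988Gauss, II §1 Théorème p. 54] -/
theorem card_sqrtsMod_eq_card_qroots {D : ℤ} {β : ℕ} {e : ℤ} (hβ : β = 0 ∨ β = 1)
    (hde : ((β : ℕ) : ℤ) ^ 2 - 4 * e = D) (n : ℕ) :
    (sqrtsMod D n).card = (qroots (β : ℤ) e n).card := by
  have hpar : ∀ b : ℕ, (4 * (n : ℤ)) ∣ (b : ℤ) ^ 2 - D → b % 2 = β := by
    rintro b ⟨k, hk⟩
    have h4 : (4 : ℤ) ∣ (b : ℤ) ^ 2 - D := ⟨n * k, by rw [hk]; ring⟩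
    rcases Nat.even_or_odd b with ⟨t, ht⟩ | ⟨t, ht⟩
    · have hb : (b : ℤ) ^ 2 - D = 4 * ((t : ℤ) ^ 2) + (-D) := by rw [ht]; push_cast; ring
      rw [hb] at h4
      have hd : (4 : ℤ) ∣ -D := (dvd_add_right (dvd_mul_right 4 ((t : ℤ) ^ 2))).mp h4
      rcases hβ with rfl | rfl
      · omega
      · exfalso; push_cast at hde; omega
    · have hb : (b : ℤ) ^ 2 - D = 4 * ((t : ℤ) ^ 2 + t) + (1 - D) := by rw [ht]; push_cast; ring
      rw [hb] at h4
      have hd : (4 : ℤ) ∣ 1 - D := (dvd_add_right (dvd_mul_right 4 ((t : ℤ) ^ 2 + t))).mp h4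
      rcases hβ with rfl | rfl
      · exfalso; push_cast at hde; omega
      · omega
  unfold sqrtsMod
  refine card_bij' (fun b _ => b / 2) (fun M _ => 2 * M + β) ?_ ?_ ?_ ?_
  · intro b hb
    rw [mem_filter, mem_range] at hb
    obtain ⟨hb2n, hdiv⟩ := hb
    have hb' : (b : ℤ) = 2 * ((b / 2 : ℕ) : ℤ) + (β : ℕ) := by
      have := hpar b hdiv
      rcases hβ with rfl | rfl <;> push_cast <;> omega
    rw [mem_qroots]
    refine ⟨by omega, ?_⟩
    obtain ⟨k, hk⟩ := hdiv
    refine ⟨k, Int.eq_of_mul_eq_mul_left (by norm_num : (4 : ℤ) ≠ 0) ?_⟩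
    rw [hb'] at hk
    linear_combination hk - hde
  · intro M hM
    rw [mem_qroots] at hM
    obtain ⟨hMn, k, hk⟩ := hM
    rw [mem_filter, mem_range]
    refine ⟨by rcases hβ with rfl | rfl <;> omega, k, ?_⟩
    push_cast
    linear_combination 4 * hk + hde
  · intro b hb
    rw [mem_filter] at hb
    have := hpar b hb.2
    rcases hβ with rfl | rfl <;> omega
  · intro M _
    rcases hβ with rfl | rfl <;> omega

/-! ### Fundamental discriminants: the two divisibility facts used at prime powers -/

/-- `D ≡ 0, 1 (mod 4)` for a fundamental discriminant `D` (tree spelling of "fundamental", as in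
`QuadraticFields/FundamentalDiscriminant.lean`). [cite: Oesterle1988Gauss, II §1 Corollaire p. 54] -/
theorem emod_four_of_isFundamental {D : ℤ}
    (hfd : (D % 4 = 1 ∧ Squarefree D ∧ D ≠ 1) ∨
      (4 ∣ D ∧ (D / 4 % 4 = 2 ∨ D / 4 % 4 = 3) ∧ Squarefree (D / 4))) :
    D % 4 = 0 ∨ D % 4 = 1 := by
  rcases hfd with ⟨h1, -, -⟩ | ⟨⟨c, hc⟩, -, -⟩
  · exact Or.inr h1
  · left; omega

/-- For a fundamental discriminant `D` and an odd prime `p`: `p² ∤ D` («sans facteurs carrés»). [cite: Oesterle1988Gauss, II §1 Corollaire p. 54] -/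
theorem not_sq_dvd_of_isFundamental {D : ℤ}
    (hfd : (D % 4 = 1 ∧ Squarefree D ∧ D ≠ 1) ∨
      (4 ∣ D ∧ (D / 4 % 4 = 2 ∨ D / 4 % 4 = 3) ∧ Squarefree (D / 4)))
    {p : ℕ} (hp : p.Prime) (hp2 : p ≠ 2) : ¬ (p : ℤ) ^ 2 ∣ D := by
  have hpint : Prime (p : ℤ) := Nat.prime_iff_prime_int.mp hp
  have hnu : ¬ IsUnit (p : ℤ) := hpint.not_unit
  intro h
  rw [sq] at h
  rcases hfd with ⟨-, hsf, -⟩ | ⟨h4, -, hsf⟩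
  · exact hnu (hsf _ h)
  · apply hnu
    refine hsf _ ?_
    have hD : D = 4 * (D / 4) := by rw [mul_comm, Int.ediv_mul_cancel h4]
    rw [hD] at h
    have hcop : IsCoprime ((p : ℤ) * p) 4 := by
      have hc : IsCoprime (p : ℤ) 2 := by
        rw [Prime.coprime_iff_not_dvd hpint]
        intro h2
        have h' : p ∣ 2 := by exact_mod_cast h2
        exact hp2 ((Nat.prime_dvd_prime_iff_eq hp Nat.prime_two).mp h')
      have h4' : (4 : ℤ) = 2 ^ 2 := by norm_num
      rw [h4']
      exact (hc.mul_left hc).pow_right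
    exact hcop.dvd_of_dvd_mul_left h

/-- An even fundamental discriminant is `≡ 8` or `12 (mod 16)`. [cite: Oesterle1988Gauss, II §1 Corollaire p. 54] -/
theorem emod_sixteen_of_isFundamental {D : ℤ}
    (hfd : (D % 4 = 1 ∧ Squarefree D ∧ D ≠ 1) ∨
      (4 ∣ D ∧ (D / 4 % 4 = 2 ∨ D / 4 % 4 = 3) ∧ Squarefree (D / 4)))
    (h2 : (2 : ℤ) ∣ D) : D % 16 = 8 ∨ D % 16 = 12 := by
  rcases hfd with ⟨h1, -, -⟩ | ⟨h4, h23, -⟩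
  · exfalso; obtain ⟨c, hc⟩ := h2; omega
  · obtain ⟨c, hc⟩ := h4; subst hc; omega

/-! ### Multiplicativity and the local values of `ρ_D` -/

/-- `ρ_D(1) = 1` (`D ≡ 0, 1 (mod 4)`). [cite: Oesterle1988Gauss, II §1 Corollaire p. 54] -/
theorem card_sqrtsMod_one {D : ℤ} (h4 : D % 4 = 0 ∨ D % 4 = 1) : (sqrtsMod D 1).card = 1 := by
  obtain ⟨β, e, hβ, hde⟩ := exists_beta_e h4
  rw [card_sqrtsMod_eq_card_qroots hβ hde 1]
  exact card_qroots_eq_one_of_squarefree squarefree_one (one_dvd _)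

/-- **`ρ_D` is multiplicative**: `ρ_D(mn) = ρ_D(m)ρ_D(n)` for coprime `m, n` (Chinese remainder
theorem, `card_qroots_mul`). [cite: Oesterle1988Gauss, II §1 p. 54 (proof of the Corollaire)] -/
theorem card_sqrtsMod_mul {D : ℤ} (h4 : D % 4 = 0 ∨ D % 4 = 1) {m n : ℕ} (hmn : m.Coprime n) :
    (sqrtsMod D (m * n)).card = (sqrtsMod D m).card * (sqrtsMod D n).card := by
  obtain ⟨β, e, hβ, hde⟩ := exists_beta_e h4
  rcases Nat.eq_zero_or_pos m with rfl | hm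
  · simp [sqrtsMod]
  rcases Nat.eq_zero_or_pos n with rfl | hn
  · simp [sqrtsMod]
  rw [card_sqrtsMod_eq_card_qroots hβ hde (m * n), card_sqrtsMod_eq_card_qroots hβ hde m,
    card_sqrtsMod_eq_card_qroots hβ hde n]
  exact card_qroots_mul hmn hm hn

/-- `rho D` is a multiplicative arithmetic function (`D ≡ 0, 1 (mod 4)`).
[cite: Oesterle1988Gauss, II §1 p. 54 (proof of the Corollaire)] -/
theorem isMultiplicative_rho {D : ℤ} (h4 : D % 4 = 0 ∨ D % 4 = 1) : (rho D).IsMultiplicative := by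
  refine ⟨?_, fun {m n} hmn => ?_⟩
  · rw [rho_apply, card_sqrtsMod_one h4, Nat.cast_one]
  · rw [rho_apply, rho_apply, rho_apply, card_sqrtsMod_mul h4 hmn, Nat.cast_mul]

/-- **Split primes**: `ρ_D(p^k) = 2` for `p ∈ 𝒫_D` (`p ∤ D`, `D` a square mod `4p`) and `k ≥ 1`.
[cite: Oesterle1988Gauss, II §1 Corollaire p. 54] -/
theorem card_sqrtsMod_prime_pow_of_mem {D : ℤ} (h4 : D % 4 = 0 ∨ D % 4 = 1) {p k : ℕ} (hk : 0 < k)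
    (hp : p ∈ kroneckerOnePrimes D) : (sqrtsMod D (p ^ k)).card = 2 := by
  obtain ⟨β, e, hβ, hde⟩ := exists_beta_e h4
  have hpp : p.Prime := prime_of_mem_kroneckerOnePrimes hp
  rw [card_sqrtsMod_eq_card_qroots hβ hde (p ^ k)]
  have h := card_qroots_eq_two_pow (b := (β : ℤ)) (e := e) (d' := 1) (m := p ^ k) squarefree_one
    (one_dvd _) (pow_pos hpp.pos k) (fun r hr => by
      rw [Nat.primeFactors_prime_pow hk.ne' hpp, mem_singleton] at hr
      rw [hr, hde]; exact hp)
  rw [one_mul, Nat.primeFactors_prime_pow hk.ne' hpp, card_singleton, pow_one] at h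
  exact h

/-- **Ramified primes, exponent one**: `ρ_D(p) = 1` for a prime `p ∣ D`.
[cite: Oesterle1988Gauss, II §1 Corollaire p. 54] -/
theorem card_sqrtsMod_prime_of_dvd {D : ℤ} (h4 : D % 4 = 0 ∨ D % 4 = 1) {p : ℕ} (hp : p.Prime)
    (hpd : (p : ℤ) ∣ D) : (sqrtsMod D p).card = 1 := by
  obtain ⟨β, e, hβ, hde⟩ := exists_beta_e h4
  rw [card_sqrtsMod_eq_card_qroots hβ hde p]
  exact card_qroots_prime_eq_one hp (by rw [hde]; exact hpd)

/-- **Ramified primes, exponent `≥ 2`**: `ρ_D(p^k) = 0` for a prime `p ∣ D`, `k ≥ 2`, `D` fundamental.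
[cite: Oesterle1988Gauss, II §1 Corollaire p. 54] -/
theorem card_sqrtsMod_prime_pow_of_dvd {D : ℤ}
    (hfd : (D % 4 = 1 ∧ Squarefree D ∧ D ≠ 1) ∨
      (4 ∣ D ∧ (D / 4 % 4 = 2 ∨ D / 4 % 4 = 3) ∧ Squarefree (D / 4)))
    {p k : ℕ} (hp : p.Prime) (hk : 2 ≤ k) (hpd : (p : ℤ) ∣ D) : (sqrtsMod D (p ^ k)).card = 0 := by
  obtain ⟨β, e, hβ, hde⟩ := exists_beta_e (emod_four_of_isFundamental hfd)
  rw [card_sqrtsMod_eq_card_qroots hβ hde (p ^ k), card_eq_zero]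
  have hfd' := hfd
  rw [← hde] at hfd'
  have hD : (p : ℤ) ∣ ((β : ℕ) : ℤ) ^ 2 - 4 * e := by rw [hde]; exact hpd
  exact qroots_prime_pow_eq_empty_of_dvd hp hk hD
    (fun hp2 => not_sq_dvd_of_isFundamental hfd' hp hp2)
    (fun hp2 => emod_sixteen_of_isFundamental hfd' (by rw [hp2] at hD; exact_mod_cast hD))

/-- **Inert primes**: `ρ_D(p^k) = 0` for a prime `p ∤ D`, `p ∉ 𝒫_D`, `k ≥ 1`.
[cite: Oesterle1988Gauss, II §1 Corollaire p. 54] -/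
theorem card_sqrtsMod_prime_pow_of_not_mem {D : ℤ} (h4 : D % 4 = 0 ∨ D % 4 = 1) {p k : ℕ}
    (hp : p.Prime) (hk : 0 < k) (hpd : ¬ (p : ℤ) ∣ D) (hP : p ∉ kroneckerOnePrimes D) :
    (sqrtsMod D (p ^ k)).card = 0 := by
  obtain ⟨β, e, hβ, hde⟩ := exists_beta_e h4
  rw [card_sqrtsMod_eq_card_qroots hβ hde (p ^ k), card_eq_zero]
  have hD : ¬ (p : ℤ) ∣ ((β : ℕ) : ℤ) ^ 2 - 4 * e := by rw [hde]; exact hpd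
  have hP' : p ∉ kroneckerOnePrimes (((β : ℕ) : ℤ) ^ 2 - 4 * e) := by rw [hde]; exact hP
  exact qroots_prime_pow_eq_empty_of_not_mem hp hk hD hP'

/-- **`ρ_D(p^k) ≤ 2`** at every prime power, `D` fundamental (`k ≥ 0`).
[cite: Oesterle1988Gauss, II §1 Corollaire p. 54] -/
theorem card_sqrtsMod_prime_pow_le_two {D : ℤ}
    (hfd : (D % 4 = 1 ∧ Squarefree D ∧ D ≠ 1) ∨
      (4 ∣ D ∧ (D / 4 % 4 = 2 ∨ D / 4 % 4 = 3) ∧ Squarefree (D / 4)))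
    {p : ℕ} (hp : p.Prime) (k : ℕ) : (sqrtsMod D (p ^ k)).card ≤ 2 := by
  have h4 := emod_four_of_isFundamental hfd
  rcases Nat.eq_zero_or_pos k with rfl | hk
  · rw [pow_zero, card_sqrtsMod_one h4]; norm_num
  by_cases hpd : (p : ℤ) ∣ D
  · rcases eq_or_lt_of_le (Nat.succ_le_of_lt hk) with hk1 | hk2
    · rw [← hk1, pow_one, card_sqrtsMod_prime_of_dvd h4 hp hpd]; norm_num
    · rw [card_sqrtsMod_prime_pow_of_dvd hfd hp (by omega) hpd]; norm_num
  by_cases hP : p ∈ kroneckerOnePrimes D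
  · rw [card_sqrtsMod_prime_pow_of_mem h4 hk hP]
  · rw [card_sqrtsMod_prime_pow_of_not_mem h4 hp hk hpd hP]; norm_num

/-! ### The identity `r = 1_□ ∗ ρ_D` -/

/-- `(1_□ ∗ f)(p^k) = Σ_{i ≤ k, i even} f(p^{k−i})`. [cite: Oesterle1988Gauss, II §2 (23) p. 56] -/
theorem sqInd_mul_apply_prime_pow (f : ArithmeticFunction ℝ) {p : ℕ} (hp : p.Prime) (k : ℕ) :
    (sqInd * f) (p ^ k) = ∑ i ∈ range (k + 1), (if Even i then (1 : ℝ) else 0) * f (p ^ (k - i)) := by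
  rw [mul_apply, Nat.sum_divisorsAntidiagonal (fun a b => sqInd a * f b), Nat.sum_divisors_prime_pow hp]
  refine sum_congr rfl fun i hi => ?_
  rw [sqInd_prime_pow hp, Nat.pow_div (by simpa [mem_range, Nat.lt_succ_iff] using hi) hp.pos]

/-- The two-step recursion `(1_□ ∗ f)(p^{k+2}) = (1_□ ∗ f)(p^k) + f(p^{k+2})`. [cite: Oesterle1988Gauss, II §2 (23) p. 56] -/
theorem sqInd_mul_apply_prime_pow_add_two (f : ArithmeticFunction ℝ) {p : ℕ} (hp : p.Prime) (k : ℕ) :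
    (sqInd * f) (p ^ (k + 2)) = (sqInd * f) (p ^ k) + f (p ^ (k + 2)) := by
  rw [sqInd_mul_apply_prime_pow f hp (k + 2), sqInd_mul_apply_prime_pow f hp k, sum_range_succ',
    sum_range_succ']
  have hg : ∀ i ∈ range (k + 1), (if Even (i + 1 + 1) then (1 : ℝ) else 0) * f (p ^ (k + 2 - (i + 1 + 1)))
      = (if Even i then (1 : ℝ) else 0) * f (p ^ (k - i)) := by
    intro i _
    have he : Even (i + 1 + 1) ↔ Even i := by simp [Nat.even_add_one]
    have hsub : k + 2 - (i + 1 + 1) = k - i := by omega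
    rw [hsub]
    simp only [he]
  rw [sum_congr rfl hg]
  have h1 : ¬ Even (0 + 1) := by decide
  have h0 : Even 0 := by decide
  simp only [if_neg h1, if_pos h0, zero_mul, add_zero, one_mul, Nat.sub_zero]

variable {q : ℕ} (χ : DirichletCharacter ℂ q)

/-- `r(p^{k+2}) = r(p^k) + χ(p)^{k+1} + χ(p)^{k+2}` for quadratic `χ`. [cite: Oesterle1988Gauss, II §2 (26) p. 56] -/
theorem charDivisorSum_prime_pow_add_two' (hq : χ ^ 2 = 1) {p : ℕ} (hp : p.Prime) (k : ℕ) :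
    charDivisorSum χ (p ^ (k + 2)) =
      charDivisorSum χ (p ^ k) + reChar χ p ^ (k + 1) + reChar χ p ^ (k + 2) := by
  rw [charDivisorSum_prime_pow χ hq hp, charDivisorSum_prime_pow χ hq hp,
    sum_range_succ _ (k + 1 + 1), sum_range_succ _ (k + 1)]

/-- The three local cases for `ρ_D` against the Kronecker values `0, 1, −1` of `χ` at a prime `p`:
`ρ_D(p) = 1 + χ(p)`. [cite: Oesterle1988Gauss, II §2 (25) p. 56] -/
theorem rho_prime_eq {D : ℤ}
    (hfd : (D % 4 = 1 ∧ Squarefree D ∧ D ≠ 1) ∨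
      (4 ∣ D ∧ (D / 4 % 4 = 2 ∨ D / 4 % 4 = 3) ∧ Squarefree (D / 4)))
    (h0 : ∀ p : ℕ, p.Prime → (p : ℤ) ∣ D → χ (p : ZMod q) = 0)
    (h1 : ∀ p ∈ kroneckerOnePrimes D, χ (p : ZMod q) = 1)
    (h2 : ∀ p : ℕ, p.Prime → ¬ (p : ℤ) ∣ D → p ∉ kroneckerOnePrimes D → χ (p : ZMod q) = -1)
    {p : ℕ} (hp : p.Prime) : rho D p = 1 + reChar χ p := by
  have h4 := emod_four_of_isFundamental hfd
  rw [rho_apply, reChar_apply χ hp.ne_zero]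
  by_cases hpd : (p : ℤ) ∣ D
  · rw [card_sqrtsMod_prime_of_dvd h4 hp hpd, h0 p hp hpd]; simp
  by_cases hP : p ∈ kroneckerOnePrimes D
  · rw [← pow_one p, card_sqrtsMod_prime_pow_of_mem h4 one_pos hP, pow_one, h1 p hP]; norm_num
  · rw [← pow_one p, card_sqrtsMod_prime_pow_of_not_mem h4 hp one_pos hpd hP, pow_one,
      h2 p hp hpd hP]; norm_num

/-- The three local cases, higher powers: `ρ_D(p^{k+2}) = χ(p)^{k+1} + χ(p)^{k+2}`
(`2 = 1 + 1`, `0 = (−1)^{k+1} + (−1)^{k+2}`, `0 = 0 + 0`). [cite: Oesterle1988Gauss, II §2 (25) p. 56] -/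
theorem rho_prime_pow_add_two_eq {D : ℤ}
    (hfd : (D % 4 = 1 ∧ Squarefree D ∧ D ≠ 1) ∨
      (4 ∣ D ∧ (D / 4 % 4 = 2 ∨ D / 4 % 4 = 3) ∧ Squarefree (D / 4)))
    (h0 : ∀ p : ℕ, p.Prime → (p : ℤ) ∣ D → χ (p : ZMod q) = 0)
    (h1 : ∀ p ∈ kroneckerOnePrimes D, χ (p : ZMod q) = 1)
    (h2 : ∀ p : ℕ, p.Prime → ¬ (p : ℤ) ∣ D → p ∉ kroneckerOnePrimes D → χ (p : ZMod q) = -1)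
    {p : ℕ} (hp : p.Prime) (k : ℕ) :
    rho D (p ^ (k + 2)) = reChar χ p ^ (k + 1) + reChar χ p ^ (k + 2) := by
  have h4 := emod_four_of_isFundamental hfd
  rw [rho_apply, reChar_apply χ hp.ne_zero]
  by_cases hpd : (p : ℤ) ∣ D
  · rw [card_sqrtsMod_prime_pow_of_dvd hfd hp (by omega) hpd, h0 p hp hpd]; simp
  by_cases hP : p ∈ kroneckerOnePrimes D
  · rw [card_sqrtsMod_prime_pow_of_mem h4 (by omega) hP, h1 p hP]; norm_num
  · rw [card_sqrtsMod_prime_pow_of_not_mem h4 hp (by omega) hpd hP, h2 p hp hpd hP]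
    norm_num [pow_succ]

/-- **`r = 1_□ ∗ ρ_D`.** For a fundamental discriminant `D` (either sign) and a quadratic Dirichlet
character `χ` (any modulus) whose values at the primes are the Kronecker symbols `(D/p)` — `0` for
`p ∣ D`, `1` for `p ∈ 𝒫_D`, `−1` otherwise — the divisor sum `r(n) = Σ_{k ∣ n} χ(k)` is
`Σ_{u² a = n} ρ_D(a)`: the number of ideals of norm `n` of the quadratic field of discriminant `D`,
each ideal being `u` times a primitive ideal `[a, (b + √D)/2]`, `N = u²a` (Goldfeld–Schinzel (3));
equivalently Oesterlé's (23) = (26), `ζ(2s) Σ ρ_D(n) n^{−s} = ζ(s) L(s, χ)`, coefficientwise. Proof: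
both sides are multiplicative and agree at prime powers by the Corollaire's local values.
[cite: GoldfeldSchinzel1975, §2 proof of Lemma 1 (3) p. 573] [cite: Oesterle1988Gauss, II §2 (25)–(26) p. 56] -/
theorem charDivisorSum_eq_sqInd_mul_rho {D : ℤ}
    (hfd : (D % 4 = 1 ∧ Squarefree D ∧ D ≠ 1) ∨
      (4 ∣ D ∧ (D / 4 % 4 = 2 ∨ D / 4 % 4 = 3) ∧ Squarefree (D / 4)))
    (hq : χ ^ 2 = 1)
    (h0 : ∀ p : ℕ, p.Prime → (p : ℤ) ∣ D → χ (p : ZMod q) = 0)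
    (h1 : ∀ p ∈ kroneckerOnePrimes D, χ (p : ZMod q) = 1)
    (h2 : ∀ p : ℕ, p.Prime → ¬ (p : ℤ) ∣ D → p ∉ kroneckerOnePrimes D → χ (p : ZMod q) = -1) :
    charDivisorSum χ = sqInd * rho D := by
  have h4 := emod_four_of_isFundamental hfd
  have hmul : (sqInd * rho D).IsMultiplicative := isMultiplicative_sqInd.mul (isMultiplicative_rho h4)
  rw [IsMultiplicative.eq_iff_eq_on_prime_powers _ (isMultiplicative_charDivisorSum χ hq) _ hmul]
  intro p k hp
  induction k using Nat.twoStepInduction with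
  | zero =>
    rw [pow_zero, (isMultiplicative_charDivisorSum χ hq).map_one, hmul.map_one]
  | one =>
    have hsq := sqInd_mul_apply_prime_pow (rho D) hp 1
    rw [pow_one] at hsq ⊢
    rw [charDivisorSum_prime χ hq hp, hsq, sum_range_succ, sum_range_one]
    have h1' : ¬ Even 1 := by decide
    have h0' : Even 0 := by decide
    simp only [if_pos h0', if_neg h1', one_mul, zero_mul, add_zero, Nat.sub_zero, pow_one]
    rw [rho_prime_eq χ hfd h0 h1 h2 hp]
  | more k ih0 _ =>
    rw [charDivisorSum_prime_pow_add_two' χ hq hp, sqInd_mul_apply_prime_pow_add_two (rho D) hp, ← ih0,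
      rho_prime_pow_add_two_eq χ hfd h0 h1 h2 hp k]
    ring

/-- Pointwise form: `r(n) = Σ_{d ∣ n} ρ_D(d) · 1_□(n/d)` (`= Σ_{u² a = n} ρ_D(a)`).
[cite: GoldfeldSchinzel1975, §2 proof of Lemma 1 (3) p. 573] -/
theorem charDivisorSum_apply_eq_sum_rho {D : ℤ}
    (hfd : (D % 4 = 1 ∧ Squarefree D ∧ D ≠ 1) ∨
      (4 ∣ D ∧ (D / 4 % 4 = 2 ∨ D / 4 % 4 = 3) ∧ Squarefree (D / 4)))
    (hq : χ ^ 2 = 1)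
    (h0 : ∀ p : ℕ, p.Prime → (p : ℤ) ∣ D → χ (p : ZMod q) = 0)
    (h1 : ∀ p ∈ kroneckerOnePrimes D, χ (p : ZMod q) = 1)
    (h2 : ∀ p : ℕ, p.Prime → ¬ (p : ℤ) ∣ D → p ∉ kroneckerOnePrimes D → χ (p : ZMod q) = -1)
    (n : ℕ) : charDivisorSum χ n = ∑ d ∈ n.divisors, rho D d * sqInd (n / d) := by
  rw [charDivisorSum_eq_sqInd_mul_rho χ hfd hq h0 h1 h2, mul_comm, mul_apply,
    Nat.sum_divisorsAntidiagonal (fun a b => rho D a * sqInd b)]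

/-! ### The primitive quadratic character mod `q` and `D = χ(−1) q` -/

/-- **`r = 1_□ ∗ ρ_D` for the primitive quadratic character mod `q > 1`, `D = χ(−1)·q`** (the
fundamental discriminant whose Kronecker symbol is `χ`, Montgomery–Vaughan Thm 9.13 — the tree's
`PrimitiveQuadratic.apply_prime_eq_legendreSym_sign_mul`, `apply_two_eq_ite_sign_mul`,
`apply_two_of_even`, `isFundamentalDiscriminant_sign_mul`).
[cite: GoldfeldSchinzel1975, §2 proof of Lemma 1 (3) p. 573] [cite: MontgomeryVaughan2007, Theorem 9.13] -/
theorem charDivisorSum_eq_sqInd_mul_rho_of_isPrimitive [NeZero q] (hq1 : 1 < q)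
    (hprim : χ.IsPrimitive) (hquad : χ.IsQuadratic) {s : ℤ} (hs : χ (-1) = (s : ℂ))
    (hs1 : s = 1 ∨ s = -1) : charDivisorSum χ = sqInd * rho (s * q) := by
  have hfd := PrimitiveQuadratic.isFundamentalDiscriminant_sign_mul hprim hquad hs hs1 hq1
  have h4 := emod_four_of_isFundamental hfd
  have hq2 : χ ^ 2 = 1 := MulChar.isQuadratic_iff_sq_eq_one.mp hquad
  -- values at odd primes: the Legendre symbol `(D/p)`
  have hodd : ∀ p : ℕ, p.Prime → p ≠ 2 → χ (p : ZMod q) = (jacobiSym (s * q) p : ℂ) := by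
    intro p hp hp2
    haveI := Fact.mk hp
    rw [PrimitiveQuadratic.apply_prime_eq_legendreSym_sign_mul hprim hquad hs hs1 p hp2,
      jacobiSym.legendreSym.to_jacobiSym]
  -- the prime 2
  have htwo_even : Even q → χ (2 : ZMod q) = 0 := fun he => PrimitiveQuadratic.apply_two_of_even he χ
  have htwo_odd : Odd q → χ (2 : ZMod q) = if (s * q : ℤ) % 8 = 1 then 1 else -1 := fun ho =>
    PrimitiveQuadratic.apply_two_eq_ite_sign_mul ho hq1 hprim hquad hs hs1
  have hsq : (2 : ℤ) ∣ s * q ↔ Even q := by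
    constructor
    · intro h
      have h' : (2 : ℤ) ∣ (q : ℤ) := by
        rcases hs1 with rfl | rfl
        · simpa using h
        · simpa using h
      exact even_iff_two_dvd.mpr (by exact_mod_cast h')
    · rintro ⟨c, hc⟩; exact ⟨s * c, by rw [hc]; push_cast; ring⟩
  refine charDivisorSum_eq_sqInd_mul_rho χ hfd hq2 ?_ ?_ ?_
  · intro p hp hpd
    by_cases hp2 : p = 2
    · subst hp2
      rw [Nat.cast_ofNat]
      exact htwo_even (hsq.mp hpd)
    · rw [hodd p hp hp2, jacobiSym_eq_zero_of_prime_dvd hp hpd]; simp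
  · intro p hP
    have hp := prime_of_mem_kroneckerOnePrimes hP
    by_cases hp2 : p = 2
    · subst hp2
      have h8 := two_mem_kroneckerOnePrimes_iff.mp hP
      have hq_odd : Odd q := by
        rcases Nat.even_or_odd q with he | ho
        · exfalso; exact not_dvd_of_mem_kroneckerOnePrimes hP (by exact_mod_cast hsq.mpr he)
        · exact ho
      rw [Nat.cast_ofNat, htwo_odd hq_odd, if_pos h8]
    · rw [hodd p hp hp2, jacobiSym_eq_one_of_mem_kroneckerOnePrimes h4 hp2 hP]; simp
  · intro p hp hpd hP
    by_cases hp2 : p = 2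
    · subst hp2
      have hq_odd : Odd q := by
        rcases Nat.even_or_odd q with he | ho
        · exfalso; exact hpd (by exact_mod_cast hsq.mpr he)
        · exact ho
      have h8 : ¬ (s * q : ℤ) % 8 = 1 := fun h => hP (two_mem_kroneckerOnePrimes_iff.mpr h)
      rw [Nat.cast_ofNat, htwo_odd hq_odd, if_neg h8]
    · rw [hodd p hp hp2, jacobiSym_eq_neg_one_of_not_mem_kroneckerOnePrimes h4 hp hp2 hpd hP]; simp

/-! ### Goldfeld–Schinzel's (3): `Σ_{n ≤ N} r(n)/n = Σ_{a ≤ N} (ρ_D(a)/a) Σ_{u² ≤ N/a} 1/u²` -/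

/-- `Σ_{m ≤ M} 1_□(m)/m = Σ_{u ≤ √M} 1/u²`. [cite: GoldfeldSchinzel1975, §2 proof of Lemma 1 (3) p. 573] -/
theorem sum_Ioc_sqInd_div (M : ℕ) :
    ∑ m ∈ Ioc 0 M, sqInd m / (m : ℝ) = ∑ u ∈ Ioc 0 (Nat.sqrt M), 1 / (u : ℝ) ^ 2 := by
  have hterm : ∀ m ∈ Ioc 0 M, sqInd m / (m : ℝ) = if IsSquare m then 1 / (m : ℝ) else 0 := by
    intro m hm
    have hm0 : m ≠ 0 := (mem_Ioc.mp hm).1.ne'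
    rw [sqInd_apply]
    by_cases h : IsSquare m
    · rw [if_pos ⟨hm0, h⟩, if_pos h]
    · rw [if_neg (fun h' => h h'.2), if_neg h, zero_div]
  rw [sum_congr rfl hterm, ← sum_filter]
  have himage : (Ioc 0 M).filter IsSquare = (Ioc 0 (Nat.sqrt M)).image fun u => u * u := by
    ext m
    simp only [mem_filter, mem_Ioc, mem_image]
    constructor
    · rintro ⟨⟨hm0, hmM⟩, r, rfl⟩
      refine ⟨r, ⟨Nat.pos_of_ne_zero ?_, Nat.le_sqrt.mpr hmM⟩, rfl⟩
      rintro rfl; simp at hm0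
    · rintro ⟨u, ⟨hu0, huM⟩, rfl⟩
      exact ⟨⟨Nat.mul_pos hu0 hu0, Nat.le_sqrt.mp huM⟩, ⟨u, rfl⟩⟩
  rw [himage, sum_image (fun x _ y _ hxy => Nat.mul_self_inj.mp hxy)]
  refine sum_congr rfl fun u _ => ?_
  rw [Nat.cast_mul, sq]

/-- **Goldfeld–Schinzel (3), exact form.** For `D` fundamental and `χ` as in
`charDivisorSum_eq_sqInd_mul_rho`: `Σ_{n ≤ N} r(n)/n = Σ_{a ≤ N} (ρ_D(a)/a) · Σ_{u ≤ √(N/a)} 1/u²`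
("Since `N𝔞 = u²a`, it follows that `Σ_{N𝔞 ≤ x} 1/N𝔞 = Σ' (1/a) Σ_{1 ≤ u² ≤ x/a} 1/u² + …`").
[cite: GoldfeldSchinzel1975, §2 proof of Lemma 1 (3) p. 573] -/
theorem sum_charDivisorSum_div_eq {D : ℤ}
    (hfd : (D % 4 = 1 ∧ Squarefree D ∧ D ≠ 1) ∨
      (4 ∣ D ∧ (D / 4 % 4 = 2 ∨ D / 4 % 4 = 3) ∧ Squarefree (D / 4)))
    (hq : χ ^ 2 = 1)
    (h0 : ∀ p : ℕ, p.Prime → (p : ℤ) ∣ D → χ (p : ZMod q) = 0)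
    (h1 : ∀ p ∈ kroneckerOnePrimes D, χ (p : ZMod q) = 1)
    (h2 : ∀ p : ℕ, p.Prime → ¬ (p : ℤ) ∣ D → p ∉ kroneckerOnePrimes D → χ (p : ZMod q) = -1)
    (N : ℕ) :
    ∑ n ∈ Ioc 0 N, charDivisorSum χ n / (n : ℝ) =
      ∑ a ∈ Ioc 0 N, rho D a / (a : ℝ) * ∑ u ∈ Ioc 0 (Nat.sqrt (N / a)), 1 / (u : ℝ) ^ 2 := by
  have hpt : ∀ n ∈ Ioc 0 N, charDivisorSum χ n / (n : ℝ) =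
      ∑ d ∈ n.divisors, (rho D d / (d : ℝ)) * (sqInd (n / d) / ((n / d : ℕ) : ℝ)) := by
    intro n hn
    have hn0 : n ≠ 0 := (mem_Ioc.mp hn).1.ne'
    rw [charDivisorSum_apply_eq_sum_rho χ hfd hq h0 h1 h2 n, sum_div]
    refine sum_congr rfl fun d hd => ?_
    have hdn : d ∣ n := Nat.dvd_of_mem_divisors hd
    have hd0 : d ≠ 0 := ne_zero_of_dvd_ne_zero hn0 hdn
    have hnd : ((n / d : ℕ) : ℝ) = (n : ℝ) / d := by
      rw [Nat.cast_div hdn (by exact_mod_cast hd0)]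
    rw [hnd]
    have hdR : (d : ℝ) ≠ 0 := by exact_mod_cast hd0
    have hnR : (n : ℝ) ≠ 0 := by exact_mod_cast hn0
    field_simp
  rw [sum_congr rfl hpt, sum_Ioc_sum_divisors_eq (fun d => rho D d / (d : ℝ))
    (fun m => sqInd m / (m : ℝ)) N]
  refine sum_congr rfl fun a _ => ?_
  rw [sum_Ioc_sqInd_div]

/-! ### The comparison sums `Σ_{u ≤ U} 1/u²` -/

/-- `Σ_{u ≤ U} 1/u² ≤ π²/6 = ζ(2)`. [cite: GoldfeldSchinzel1975, §2 proof of Lemma 1 (3) p. 573] -/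
theorem sum_inv_sq_le (U : ℕ) : ∑ u ∈ Ioc 0 U, 1 / (u : ℝ) ^ 2 ≤ Real.pi ^ 2 / 6 :=
  sum_le_hasSum (Ioc 0 U) (fun n _ => by positivity) hasSum_zeta_two

/-- The telescoping tail: `Σ_{U < u ≤ V} 1/u² ≤ 1/U − 1/V` for `1 ≤ U ≤ V`. [cite: GoldfeldSchinzel1975, §2 proof of Lemma 1 (3) p. 573] -/
theorem sum_Ioc_inv_sq_le {U V : ℕ} (hU : 0 < U) (hUV : U ≤ V) :
    ∑ u ∈ Ioc U V, 1 / (u : ℝ) ^ 2 ≤ 1 / (U : ℝ) - 1 / (V : ℝ) := by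
  induction V, hUV using Nat.le_induction with
  | base => simp
  | succ V hV ih =>
    rw [sum_Ioc_succ_top (by omega), Nat.cast_succ]
    have hV0 : (0 : ℝ) < V := by exact_mod_cast (lt_of_lt_of_le hU hV)
    have hkey : 1 / ((V : ℝ) + 1) ^ 2 ≤ 1 / (V : ℝ) - 1 / ((V : ℝ) + 1) := by
      rw [div_sub_div _ _ hV0.ne' (by linarith), div_le_div_iff₀ (by positivity) (by positivity)]
      nlinarith
    linarith

/-- **`Σ_{u ≤ U} 1/u² ≥ π²/6 − 1/U`** for `U ≥ 1` (the source's `Σ_{u² ≤ x/a} 1/u² = π²/6 + O(f^{−1/2})`).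
[cite: GoldfeldSchinzel1975, §2 proof of Lemma 1 (3) p. 573] -/
theorem pi_sq_div_six_sub_le_sum_inv_sq {U : ℕ} (hU : 0 < U) :
    Real.pi ^ 2 / 6 - 1 / (U : ℝ) ≤ ∑ u ∈ Ioc 0 U, 1 / (u : ℝ) ^ 2 := by
  have hlim := hasSum_zeta_two.tendsto_sum_nat
  -- every long partial sum is `≤ Σ_{u ≤ U} + 1/U`
  have hev : ∀ᶠ n : ℕ in Filter.atTop,
      ∑ i ∈ range n, 1 / (i : ℝ) ^ 2 ≤ ∑ u ∈ Ioc 0 U, 1 / (u : ℝ) ^ 2 + 1 / (U : ℝ) := by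
    refine Filter.eventually_atTop.mpr ⟨U + 1, fun n hn => ?_⟩
    have hsplit : range n = insert 0 (Ioc 0 (n - 1)) := by
      ext i; simp only [mem_range, mem_insert, mem_Ioc]; omega
    have hsplit2 : Ioc 0 (n - 1) = Ioc 0 U ∪ Ioc U (n - 1) := by
      rw [Ioc_union_Ioc_eq_Ioc (by omega) (by omega)]
    rw [hsplit, sum_insert (by simp), hsplit2, sum_union (Ioc_disjoint_Ioc_of_le (le_refl U))]
    simp only [Nat.cast_zero, ne_eq, OfNat.ofNat_ne_zero, not_false_eq_true, zero_pow, div_zero,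
      zero_add]
    have ht := sum_Ioc_inv_sq_le hU (show U ≤ n - 1 by omega)
    have hV : 0 ≤ 1 / ((n - 1 : ℕ) : ℝ) := by positivity
    linarith
  have hle : Real.pi ^ 2 / 6 ≤ ∑ u ∈ Ioc 0 U, 1 / (u : ℝ) ^ 2 + 1 / (U : ℝ) :=
    le_of_tendsto hlim hev
  linarith

/-- **Upper comparison**: `Σ_{n ≤ N} r(n)/n ≤ (π²/6) Σ_{a ≤ N} ρ_D(a)/a`.
[cite: GoldfeldSchinzel1975, §2 proof of Lemma 1 (3) p. 573] -/
theorem sum_charDivisorSum_div_le {D : ℤ}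
    (hfd : (D % 4 = 1 ∧ Squarefree D ∧ D ≠ 1) ∨
      (4 ∣ D ∧ (D / 4 % 4 = 2 ∨ D / 4 % 4 = 3) ∧ Squarefree (D / 4)))
    (hq : χ ^ 2 = 1)
    (h0 : ∀ p : ℕ, p.Prime → (p : ℤ) ∣ D → χ (p : ZMod q) = 0)
    (h1 : ∀ p ∈ kroneckerOnePrimes D, χ (p : ZMod q) = 1)
    (h2 : ∀ p : ℕ, p.Prime → ¬ (p : ℤ) ∣ D → p ∉ kroneckerOnePrimes D → χ (p : ZMod q) = -1)
    (N : ℕ) :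
    ∑ n ∈ Ioc 0 N, charDivisorSum χ n / (n : ℝ) ≤
      Real.pi ^ 2 / 6 * ∑ a ∈ Ioc 0 N, rho D a / (a : ℝ) := by
  rw [sum_charDivisorSum_div_eq χ hfd hq h0 h1 h2 N, mul_sum]
  refine sum_le_sum fun a _ => ?_
  rw [mul_comm]
  exact mul_le_mul_of_nonneg_right (sum_inv_sq_le _) (div_nonneg (rho_nonneg D a) (Nat.cast_nonneg _))

/-- **Lower comparison**: for `1 ≤ M ≤ N`, `Σ_{n ≤ N} r(n)/n ≥ (π²/6 − 1/⌊√(N/M)⌋) Σ_{a ≤ M} ρ_D(a)/a`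
(keep `a ≤ M`; then `√(N/a) ≥ √(N/M)`). [cite: GoldfeldSchinzel1975, §2 proof of Lemma 1 (3) p. 573] -/
theorem sum_charDivisorSum_div_ge {D : ℤ}
    (hfd : (D % 4 = 1 ∧ Squarefree D ∧ D ≠ 1) ∨
      (4 ∣ D ∧ (D / 4 % 4 = 2 ∨ D / 4 % 4 = 3) ∧ Squarefree (D / 4)))
    (hq : χ ^ 2 = 1)
    (h0 : ∀ p : ℕ, p.Prime → (p : ℤ) ∣ D → χ (p : ZMod q) = 0)
    (h1 : ∀ p ∈ kroneckerOnePrimes D, χ (p : ZMod q) = 1)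
    (h2 : ∀ p : ℕ, p.Prime → ¬ (p : ℤ) ∣ D → p ∉ kroneckerOnePrimes D → χ (p : ZMod q) = -1)
    {M N : ℕ} (hM : 0 < M) (hMN : M ≤ N) :
    (Real.pi ^ 2 / 6 - 1 / (Nat.sqrt (N / M) : ℝ)) * ∑ a ∈ Ioc 0 M, rho D a / (a : ℝ) ≤
      ∑ n ∈ Ioc 0 N, charDivisorSum χ n / (n : ℝ) := by
  have hU : 0 < Nat.sqrt (N / M) := Nat.sqrt_pos.mpr (Nat.div_pos hMN hM)
  rw [sum_charDivisorSum_div_eq χ hfd hq h0 h1 h2 N, mul_sum]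
  calc ∑ a ∈ Ioc 0 M, (Real.pi ^ 2 / 6 - 1 / (Nat.sqrt (N / M) : ℝ)) * (rho D a / (a : ℝ))
      ≤ ∑ a ∈ Ioc 0 M, rho D a / (a : ℝ) * ∑ u ∈ Ioc 0 (Nat.sqrt (N / a)), 1 / (u : ℝ) ^ 2 := by
        refine sum_le_sum fun a ha => ?_
        have ha0 : 0 < a := (mem_Ioc.mp ha).1
        have haM : a ≤ M := (mem_Ioc.mp ha).2
        rw [mul_comm]
        refine mul_le_mul_of_nonneg_left ?_ (div_nonneg (rho_nonneg D a) (Nat.cast_nonneg _))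
        refine (pi_sq_div_six_sub_le_sum_inv_sq hU).trans ?_
        refine sum_le_sum_of_subset_of_nonneg (Ioc_subset_Ioc_right ?_) fun _ _ _ => by positivity
        exact Nat.sqrt_le_sqrt (Nat.div_le_div_left haM ha0)
    _ ≤ ∑ a ∈ Ioc 0 N, rho D a / (a : ℝ) * ∑ u ∈ Ioc 0 (Nat.sqrt (N / a)), 1 / (u : ℝ) ^ 2 :=
        sum_le_sum_of_subset_of_nonneg (Ioc_subset_Ioc_right hMN) fun _ _ _ => by
          exact mul_nonneg (div_nonneg (rho_nonneg D _) (Nat.cast_nonneg _))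
            (sum_nonneg fun _ _ => by positivity)

end Literature.NumberTheory.LFunctions.DiscRootCount

end
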